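import Literature.AlgebraicGeometry.Resolution.NeronPopescuSteps
import Literature.AlgebraicGeometry.Resolution.RegularLocalRingsQuotient
import Literature.RingTheory.Flat.RegularFibreFlat
import Mathlib.RingTheory.Regular.RegularSequence
import Mathlib.RingTheory.Smooth.Field
import HarnessLib

/-!
# Inputs of the last step of Stacks 07FE: flatness (Algebra 07DY) and ind-smoothness of a
# separable extension (Algebra 07BV), proved

Topic: `Literature/AlgebraicGeometry/Resolution`. Support file of the INLINE proof of the named
fact `Stacks07FE_resolveSpecial` (Stacks, *Smoothing Ring Maps*, Lemma 07FE) vendored in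
`NeronPopescuSteps.lean`; companion of `NeronPopescuOgoma.lean` (07FC, 07FD). The printed proof
of 07FE ends: "Since `x₁, …, x_d` map to a regular sequence in `Λ_𝔮` we see that `R_𝔭 → Λ_𝔮` is
flat, see Algebra, Lemma 07DY. Hence `R_𝔭/(x₁^e, …, x_d^e) → Λ_𝔮/(π₁^e, …, π_d^e)` is a flat map
of Artinian local rings; the residue field extension is separable by assumption, so this map is
a filtered colimit of smooth algebras by Algebra, Lemma 07BV and Proposition 07CM." This file
PROVES the two *Algebra* inputs of that paragraph, sorry-free and with no new named fact:

* `flat_of_ofList_eq_maximalIdeal_of_isWeaklyRegular`,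
  `Stacks07DY_flat_of_parameters_map_isWeaklyRegular` — **Algebra, Lemma 07DY**: a local
  homomorphism `R → S` of Noetherian local rings under which generators `x₁, …, x_d` of `𝔪_R`
  (e.g. a regular system of parameters of a regular `R`) map to a regular sequence in `S` is
  flat. Proof as printed (induction on `d` through the local criterion of flatness), each step
  being Matsumura's Thm. 22.3 in the form
  `Literature.RingTheory.Flat.flat_of_flat_quotient_of_isSMulRegular` (`RegularFibreFlat.lean`),
  the base case the local criterion `flat_of_injective_lTensor_maximalIdeal` with `𝔪_R = 0`.
* `factorsThroughSmooth_of_isSeparableFieldExtension` — **Algebra, Lemma 07BV** (second part,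
  with Lemmas 037X and 07ND) in the factorisation form of Algebra, Lemma 07C3 used throughout
  the chapter (`FactorsThroughSmooth`, `NeronPopescuSingularIdeal.lean`): if `K/k` is separable
  in the sense of Algebra, Def. 030O (`IsSeparableFieldExtension`), every `k`-algebra map
  `A → K` with `A` of finite type factors through a smooth `k`-algebra. Proof: the image `k[t]`
  has fraction field `k(t)`, finitely generated hence separably generated, hence formally smooth
  over `k` (Mathlib's `Algebra.FormallySmooth.of_algebraicIndependent_of_isSeparable`); thus
  `k[t]` is smooth at `(0)` and some `k[t]_g`, `g ≠ 0`, is smooth over `k`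
  (`Algebra.IsSmoothAt.exists_notMem_smooth`); factor `A → k[t]_g → K`.

## Sources

* The Stacks Project, *Smoothing Ring Maps* (Tag 07BW), proof of Lemma 07FE; *Algebra*:
  Lemma 07DY (10.128.2) with 00MK (10.99.10), Lemma 07BV (10.158.11), Lemma 037X (10.158.10),
  Lemma 07ND (10.140.9), Lemma 07C3 (10.127.4), Def. 030O. [StacksProject]
* H. Matsumura, *Commutative Ring Theory*, CUP 1986, §22 Thm. 22.3, §23 proof of Thm. 23.1
  (via `Literature.RingTheory.Flat.LocalCriterion`, `RegularFibreFlat`). [Matsumura1987]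
-/

noncomputable section

namespace Literature.AlgebraicGeometry.Resolution

universe u v

open IsLocalRing RingTheory.Sequence
open scoped Pointwise

/-! ## Stacks, Algebra 07DY: flatness from a regular sequence of parameters -/

section Stacks07DY

open Literature.RingTheory.Flat

/-- **Stacks, Algebra, Lemma 07DY, core statement.** Let `A → B` be a local homomorphism of
Noetherian local rings and `x₁, …, x_d` generators of `𝔪_A` whose images form a (weakly)
regular sequence on `B`. Then `B` is flat over `A`. Printed proof: "`B/(x₁, …, x_d)B` is flat
over `A/(x₁, …, x_d)`, the latter being a field; `x_d` is a non-zero-divisor on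
`B/(x₁, …, x_{d-1})B`, so by the local criterion of flatness (Algebra 10.99.10)
`B/(x₁, …, x_{d-1})B` is flat over `A/(x₁, …, x_{d-1})`; continuing inductively, `B` is flat
over `A`." We induct from the other end (slice by `x₁` first), each step being
`Literature.RingTheory.Flat.flat_of_flat_quotient_of_isSMulRegular` (Matsumura 22.3).
[cite: StacksProject, Tag 07DY] -/
theorem flat_of_ofList_eq_maximalIdeal_of_isWeaklyRegular :
    ∀ (n : ℕ) {A : Type u} [CommRing A] [IsNoetherianRing A] [IsLocalRing A] {B : Type v}
      [CommRing B] [Algebra A B] [IsNoetherianRing B] [IsLocalRing B]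
      [IsLocalHom (algebraMap A B)] (xs : List A), xs.length = n →
      Ideal.ofList xs = maximalIdeal A → IsWeaklyRegular B (xs.map (algebraMap A B)) →
        Module.Flat A B := by
  intro n
  induction n with
  | zero =>
    intro A _ _ _ B _ _ _ _ _ xs hlen hspan _
    have hxs : xs = [] := List.eq_nil_of_length_eq_zero hlen
    rw [hxs, Ideal.ofList_nil] at hspan
    refine flat_of_injective_lTensor_maximalIdeal (B := B) (M := B) ?_
    rw [← hspan]
    exact lTensor_subtype_bot_injective
  | succ n ih =>
    intro A _ _ _ B _ _ _ _ _ xs hlen hspan hreg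
    obtain ⟨x, xs', rfl⟩ : ∃ x xs', xs = x :: xs' := by
      cases xs with
      | nil => exact absurd hlen (by simp)
      | cons x xs' => exact ⟨x, xs', rfl⟩
    have hlen' : xs'.length = n := by simpa using hlen
    set f := algebraMap A B with hf
    rw [List.map_cons, isWeaklyRegular_cons_iff] at hreg
    obtain ⟨hx, hrest⟩ := hreg
    have hxm : x ∈ maximalIdeal A := hspan ▸ Ideal.subset_span List.mem_cons_self
    -- `A' = A/xA`, `B' = B/xB`
    set J : Ideal A := Ideal.span {x} with hJ
    set I' : Ideal B := J.map f with hI'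
    have hI'span : I' = Ideal.span {f x} := by
      rw [hI', hJ, Ideal.map_span, Set.image_singleton]
    have hxB : f x ∈ maximalIdeal B := map_nonunit f x hxm
    have hI'le : I' ≤ maximalIdeal B := by
      rw [hI'span, Ideal.span_le, Set.singleton_subset_iff]
      exact hxB
    have hJle : J ≤ maximalIdeal A := by
      rw [hJ, Ideal.span_le, Set.singleton_subset_iff]
      exact hxm
    have hJne : J ≠ ⊤ := ne_top_of_le_ne_top (maximalIdeal.isMaximal A).ne_top hJle
    have hI'ne : I' ≠ ⊤ := ne_top_of_le_ne_top (maximalIdeal.isMaximal B).ne_top hI'le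
    haveI : Nontrivial (A ⧸ J) := Ideal.Quotient.nontrivial_iff.mpr hJne
    haveI : Nontrivial (B ⧸ I') := Ideal.Quotient.nontrivial_iff.mpr hI'ne
    haveI : IsLocalRing (A ⧸ J) := isLocalRing_quotient hJne
    haveI : IsLocalRing (B ⧸ I') := isLocalRing_quotient hI'ne
    have hmA' : maximalIdeal (A ⧸ J) = (maximalIdeal A).map (Ideal.Quotient.mk J) :=
      maximalIdeal_quotient_eq_map J
    have hmB' : maximalIdeal (B ⧸ I') = (maximalIdeal B).map (Ideal.Quotient.mk I') :=
      maximalIdeal_quotient_eq_map I'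
    -- `A' → B'` is local
    haveI : IsLocalHom (algebraMap (A ⧸ J) (B ⧸ I')) := by
      refine ⟨fun a' ha' => ?_⟩
      obtain ⟨a, rfl⟩ := Ideal.Quotient.mk_surjective a'
      by_contra hna
      have ha : a ∈ maximalIdeal A := by
        by_contra ha
        exact hna ((IsLocalRing.notMem_maximalIdeal.mp ha).map (Ideal.Quotient.mk J))
      have h1 : Ideal.Quotient.mk I' (f a) ∈ maximalIdeal (B ⧸ I') := by
        rw [hmB']
        exact Ideal.mem_map_of_mem _ (map_nonunit f a ha)
      rw [Ideal.Quotient.algebraMap_quotient_map_quotient] at ha'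
      exact ((IsLocalRing.mem_maximalIdeal _).mp h1) ha'
    -- the images of `xs'` generate `𝔪_{A'}`
    have hspan' : Ideal.ofList (xs'.map (Ideal.Quotient.mk J)) = maximalIdeal (A ⧸ J) := by
      rw [hmA', ← hspan, Ideal.map_ofList, List.map_cons, Ideal.ofList_cons,
        Ideal.Quotient.eq_zero_iff_mem.mpr (Ideal.mem_span_singleton_self x),
        Ideal.span_singleton_zero, bot_sup_eq]
    -- and form a weakly regular sequence on `B'`
    have hsub : ((f x) • ⊤ : Submodule B B) = Submodule.restrictScalars B I' := by
      rw [hI'span, ← Submodule.ideal_span_singleton_smul, Ideal.smul_eq_mul, Ideal.mul_top]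
      rfl
    let e : QuotSMulTop (f x) B ≃ₗ[B] B ⧸ I' := Submodule.quotEquivOfEq _ _ hsub
    have hreg' : IsWeaklyRegular (B ⧸ I')
        ((xs'.map (Ideal.Quotient.mk J)).map (algebraMap (A ⧸ J) (B ⧸ I'))) := by
      rw [List.map_map]
      refine (AddEquiv.isWeaklyRegular_congr (e := e.toAddEquiv) ?_).mp hrest
      refine List.forall₂_map_left_iff.mpr (List.forall₂_map_right_iff.mpr
        (List.forall₂_same.mpr fun y _ m => ?_))
      change e (f y • m) = (algebraMap (A ⧸ J) (B ⧸ I') (Ideal.Quotient.mk J y)) • e m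
      rw [LinearEquiv.map_smul, Ideal.Quotient.algebraMap_quotient_map_quotient]
      obtain ⟨c, hc⟩ := Ideal.Quotient.mk_surjective (e m)
      rw [← hc, Algebra.smul_def, Ideal.Quotient.algebraMap_eq, smul_eq_mul]
    -- induction hypothesis and Matsumura 22.3
    haveI : Module.Flat (A ⧸ J) (B ⧸ I') := ih (xs'.map (Ideal.Quotient.mk J))
      (by rw [List.length_map, hlen']) hspan' hreg'
    exact flat_of_flat_quotient_of_isSMulRegular hxm hx

/-- **Stacks, Algebra, Lemma 07DY**: "Let `R → S` be a homomorphism of Noetherian local rings.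
Assume that `R` is a regular local ring and that a regular system of parameters maps to a
regular sequence in `S`. Then `R → S` is flat." (The homomorphism is local, as a regular system
of parameters maps into `𝔪_S`; regularity of `R` is not used beyond the existence of the
parameters `x₁, …, x_d` generating `𝔪_R`.) [cite: StacksProject, Tag 07DY] -/
theorem Stacks07DY_flat_of_parameters_map_isWeaklyRegular {R : Type u} [CommRing R]
    [IsRegularLocalRing R] {S : Type v} [CommRing S] [Algebra R S] [IsNoetherianRing S]
    [IsLocalRing S] [IsLocalHom (algebraMap R S)] {d : ℕ} (x : Fin d → R)
    (hx : Ideal.span (Set.range x) = maximalIdeal R)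
    (hreg : IsWeaklyRegular S (List.ofFn fun i => algebraMap R S (x i))) : Module.Flat R S := by
  refine flat_of_ofList_eq_maximalIdeal_of_isWeaklyRegular d (List.ofFn x) (List.length_ofFn ..)
    ?_ ?_
  · rw [← hx, Ideal.ofList]
    congr 1
    ext a
    exact List.mem_ofFn' x a
  · rw [List.map_ofFn]
    exact hreg

end Stacks07DY

/-! ## Stacks 07BV in factorisation form: separable extensions are ind-smooth -/

section SeparableIndSmooth

open scoped IntermediateField.algebraAdjoinAdjoin

/-- **Stacks, Algebra, Lemma 07BV** (second part: "If `K/k` is separable, then `K` is a filtered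
colimit of smooth algebras over `k`", via Lemma 037X "`K` f.g. and separable over `k` iff `K`
is the localization of a smooth `k`-algebra" and 07ND), in the factorisation form of Algebra,
Lemma 07C3: every `k`-algebra map `A → K` with `A` of finite type factors through a smooth
`k`-algebra. Proof: the image `k[t] ⊆ K` has fraction field `k(t)`, finitely generated hence
separably generated (Def. 030O), hence formally smooth over `k`; so `k[t]` is smooth at `(0)`
and some `k[t]_g`, `g ≠ 0`, is smooth over `k`; factor `A → k[t]_g → K`.
[cite: StacksProject, Tag 07BV] -/
theorem factorsThroughSmooth_of_isSeparableFieldExtension {k K : Type u} [Field k] [Field K]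
    [Algebra k K] (hK : IsSeparableFieldExtension k K) {A : Type u} [CommRing A] [Algebra k A]
    [Algebra.FiniteType k A] (φ : A →ₐ[k] K) : FactorsThroughSmooth k φ := by
  classical
  -- generators `t` of the image `φ(A) = k[t]`, and the subfield `L = k(t)`
  obtain ⟨t, ht⟩ : φ.range.FG := by
    rw [← Algebra.map_top]
    exact Subalgebra.FG.map _ Algebra.FiniteType.out
  set S : Subalgebra k K := Algebra.adjoin k (t : Set K) with hS_def
  set L : IntermediateField k K := IntermediateField.adjoin k (t : Set K) with hL_def
  haveI : Algebra.FiniteType k S := .adjoin_of_finite t.finite_toSet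
  haveI : Algebra.FinitePresentation k S :=
    (Algebra.FinitePresentation.of_finiteType (R := k) (A := S)).mp inferInstance
  -- `L/k` is finitely generated, hence separably generated, hence formally smooth
  obtain ⟨s, hs, hsep⟩ := hK L (IntermediateField.fg_adjoin_finset t)
  haveI : Algebra.FormallySmooth k L := by
    have : Algebra.IsSeparable (IntermediateField.adjoin k (Set.range ((↑) : s → L))) L := by
      convert! hsep <;> simp
    exact .of_algebraicIndependent_of_isSeparable hs.1
  -- the local ring of `S = k[t]` at `(0)` is `L = k(t)`
  haveI hfrac : IsFractionRing S (Localization.AtPrime (⊥ : Ideal S)) := by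
    simpa [Ideal.primeCompl_bot] using
      Localization.isLocalization (M := (⊥ : Ideal S).primeCompl)
  let e : Localization.AtPrime (⊥ : Ideal S) ≃ₐ[S] L :=
    IsLocalization.algEquiv (nonZeroDivisors S) _ _
  haveI : Algebra.IsSmoothAt k (⊥ : Ideal S) :=
    Algebra.FormallySmooth.of_equiv (e.restrictScalars k).symm
  obtain ⟨g, hg0, hsmooth⟩ := Algebra.IsSmoothAt.exists_notMem_smooth k (⊥ : Ideal S)
  have hg : (g : K) ≠ 0 := fun h => hg0 (by
    rw [Ideal.mem_bot]
    exact_mod_cast h)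
  -- `S_g → K`
  have hunit : ∀ y : Submonoid.powers g, IsUnit (S.val y) := by
    rintro ⟨y, n, rfl⟩
    exact isUnit_iff_ne_zero.mpr (by simpa using pow_ne_zero n hg)
  let w : Localization.Away g →ₐ[k] K := IsLocalization.liftAlgHom hunit
  -- `A → S → S_g`
  have hφS : ∀ a, φ a ∈ S := fun a => by
    have ha : φ a ∈ φ.range := φ.mem_range_self a
    rwa [← ht] at ha
  let v : A →ₐ[k] Localization.Away g :=
    (IsScalarTower.toAlgHom k S (Localization.Away g)).comp (φ.codRestrict S hφS)
  refine ⟨Localization.Away g, inferInstance, inferInstance, hsmooth, v, w, ?_⟩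
  ext a
  change w (algebraMap S (Localization.Away g) (φ.codRestrict S hφS a)) = φ a
  rw [IsLocalization.coe_liftAlgHom, IsLocalization.lift_eq]
  rfl

end SeparableIndSmooth

end Literature.AlgebraicGeometry.Resolution

end
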